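import Mathlib.NumberTheory.Zsqrtd.GaussianInt
import Mathlib.Tactic

/-!
# `n² + 1` is prime iff `n + i` has no unimodular factorisation

Soloist artefact (family `parity`, seat `solo-Parity-informed`, session 3): the dictionary between
Landau's problem and the automorphic / Gaussian side (Hooley, Bykovskii, Duke–Friedlander–Iwaniec,
Tóth, Grimmelt–Merikoski count roots of `ν² ≡ −1 (mod k)`, i.e. FACTORISATIONS of `n + i`).

By Brahmagupta–Fibonacci, `(a² + b²)(c² + d²) = (ac − bd)² + (ad + bc)²`; so every integer
solution of
`a d + b c = 1,  a c − b d = n`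
("a unimodular factorisation of `n`": `det (a, b; −c, d) = ad + bc = 1`) exhibits
`n² + 1 = (a² + b²)(c² + d²)`, i.e. the Gaussian factorisation `n + i = (a + bi)(c + di)`.  This file proves the equivalence

* `sq_add_one_prime_iff_unimodular`: for `n ≥ 1`, `n² + 1` is prime iff every unimodular
  factorisation of `n` is trivial (`a² + b² = 1` or `c² + d² = 1`),

from its two halves `unimodular_trivial_of_prime` (Brahmagupta's identity alone) and
`exists_unimodular_of_not_prime` (unique factorisation in `ℤ[i]`, through the Euclidean
algorithm: for a prime `p ∣ n² + 1`, `gcd(n + i, p)` has norm exactly `p`, because `p ∤ n ± i`).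

Reading (PLAN §8.2 (vi) of the seat): the spectral theory of `SL₂(ℤ)\ℍ` gives asymptotics, with
power savings, for the number of such factorisations (`∑ τ(n² + 1)`, roots of quadratic
congruences — divisor-type, "Type I" data), whereas primality of `n² + 1` is the statement that
the factorisation count is minimal; passing from one to the other is an inclusion–exclusion over
factorisations, a sieve of dimension one, where the parity obstruction applies.

All statements are over Mathlib (`GaussianInt = ℤ√(−1)`); no new definitions.
-/

namespace Summit.Parity.BatemanHorn.Theorems

open Zsqrtd GaussianInt

local notation "ℤ[i]" => GaussianInt

/-- Brahmagupta–Fibonacci. [folklore] -/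
theorem brahmagupta_fibonacci (a b c d : ℤ) :
    (a ^ 2 + b ^ 2) * (c ^ 2 + d ^ 2) = (a * c - b * d) ^ 2 + (a * d + b * c) ^ 2 := by
  ring

/-- If `n² + 1` is prime, every unimodular factorisation `ad + bc = 1`, `ac − bd = n` is trivial.
[folklore] -/
theorem unimodular_trivial_of_prime {n : ℕ} (hp : (n ^ 2 + 1).Prime) {a b c d : ℤ}
    (h1 : a * d + b * c = 1) (hn : a * c - b * d = n) :
    a ^ 2 + b ^ 2 = 1 ∨ c ^ 2 + d ^ 2 = 1 := by
  have key : (a ^ 2 + b ^ 2) * (c ^ 2 + d ^ 2) = ((n ^ 2 + 1 : ℕ) : ℤ) := by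
    rw [brahmagupta_fibonacci, h1, hn]; push_cast; ring
  obtain ⟨u, hu⟩ := Int.eq_ofNat_of_zero_le (by positivity : (0 : ℤ) ≤ a ^ 2 + b ^ 2)
  obtain ⟨v, hv⟩ := Int.eq_ofNat_of_zero_le (by positivity : (0 : ℤ) ≤ c ^ 2 + d ^ 2)
  rw [hu, hv] at key ⊢
  norm_cast at key ⊢
  rw [← key] at hp
  rcases Nat.prime_mul_iff.mp hp with ⟨-, rfl⟩ | ⟨-, rfl⟩
  · exact Or.inr rfl
  · exact Or.inl rfl

/-- A rational prime `p` divides no Gaussian integer with imaginary part `±1`. [folklore] -/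
theorem not_natPrime_dvd_of_im {p : ℕ} (hp : p.Prime) {t : ℤ[i]} (ht : t.im = 1 ∨ t.im = -1) :
    ¬ (p : ℤ[i]) ∣ t := by
  rintro ⟨s, hs⟩
  have him : t.im = p * s.im := by
    rw [hs, Zsqrtd.im_mul]
    simp
  have hdvd : (p : ℤ) ∣ 1 := by
    rcases ht with h | h
    · exact ⟨s.im, by rw [h] at him; exact him⟩
    · exact dvd_neg.mp ⟨s.im, by rw [h] at him; exact him⟩
  have : p ∣ 1 := by exact_mod_cast hdvd
  exact hp.one_lt.ne' (Nat.dvd_one.mp this)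

/-- If `n² + 1` (`n ≥ 1`) is NOT prime, then `n` has a non-trivial unimodular factorisation:
integers with `ad + bc = 1`, `ac − bd = n`, `a² + b² > 1`, `c² + d² > 1` — i.e. `n + i` factors
non-trivially in `ℤ[i]`.  [folklore; Euclidean algorithm in `ℤ[i]`] -/
theorem exists_unimodular_of_not_prime {n : ℕ} (hn : 1 ≤ n) (hnp : ¬ (n ^ 2 + 1).Prime) :
    ∃ a b c d : ℤ, a * d + b * c = 1 ∧ a * c - b * d = n ∧
      1 < a ^ 2 + b ^ 2 ∧ 1 < c ^ 2 + d ^ 2 := by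
  have h2 : n ^ 2 + 1 ≠ 1 := by have := Nat.one_le_pow 2 n hn; omega
  obtain ⟨p, hp, hpd⟩ := Nat.exists_prime_and_dvd h2
  set z : ℤ[i] := ⟨n, 1⟩ with hz
  have hzn : z.norm = n ^ 2 + 1 := by rw [Zsqrtd.norm_def, hz]; ring
  have hzN : (z.norm : ℤ[i]) = ((n ^ 2 + 1 : ℕ) : ℤ[i]) := by rw [hzn]; push_cast; rfl
  have hpz : ¬ (p : ℤ[i]) ∣ z := not_natPrime_dvd_of_im hp (Or.inl rfl)
  have hpz' : ¬ (p : ℤ[i]) ∣ star z := not_natPrime_dvd_of_im hp (Or.inr (by simp [hz]))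
  set g : ℤ[i] := EuclideanDomain.gcd z (p : ℤ[i]) with hg
  have hgz : g ∣ z := EuclideanDomain.gcd_dvd_left _ _
  have hgp : g ∣ (p : ℤ[i]) := EuclideanDomain.gcd_dvd_right _ _
  -- `g` is not a unit: otherwise Bézout gives `p ∣ conj z`.
  have hgu : ¬ IsUnit g := by
    intro hu
    have hbez : g = z * EuclideanDomain.gcdA z (p : ℤ[i]) + (p : ℤ[i]) *
        EuclideanDomain.gcdB z (p : ℤ[i]) := EuclideanDomain.gcd_eq_gcd_ab z _
    have hdiv : (p : ℤ[i]) ∣ g * star z := by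
      have e : g * star z = (z.norm : ℤ[i]) * EuclideanDomain.gcdA z (p : ℤ[i]) +
          (p : ℤ[i]) * (EuclideanDomain.gcdB z (p : ℤ[i]) * star z) := by
        rw [Zsqrtd.norm_eq_mul_conj, hbez]; ring
      rw [e, hzN]
      exact dvd_add ((Nat.cast_dvd_cast hpd).mul_right _) (dvd_mul_right _ _)
    exact hpz' (hu.dvd_mul_left.mp hdiv)
  -- `N(g) ∣ p²`, hence `N(g) ∈ {1, p, p²}`; the extreme cases are excluded.
  obtain ⟨t, ht⟩ := hgp
  have hnorm : (p : ℤ) * p = g.norm * t.norm := by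
    have := congrArg Zsqrtd.norm ht
    rwa [Zsqrtd.norm_natCast, Zsqrtd.norm_mul] at this
  have hg0 : 0 ≤ g.norm := GaussianInt.norm_nonneg g
  have ht0 : 0 ≤ t.norm := GaussianInt.norm_nonneg t
  have hgabs : g.norm.natAbs ∣ p ^ 2 := by
    rw [sq, ← Int.natAbs_natCast (p * p), Nat.cast_mul]
    exact Int.natAbs_dvd_natAbs.mpr ⟨t.norm, hnorm⟩
  obtain ⟨i, hi, hgi⟩ := (Nat.dvd_prime_pow hp).mp hgabs
  have hgN : g.norm = (p : ℤ) ^ i := by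
    rw [← Int.natAbs_of_nonneg hg0, hgi]; push_cast; rfl
  interval_cases i
  · -- `N(g) = 1`: `g` is a unit.
    exact absurd ((Zsqrtd.norm_eq_one_iff' (by norm_num) g).mp (by simpa using hgN)) hgu
  · -- `N(g) = p`: the factorisation `z = g · w` is the one we want.
    obtain ⟨w, hw⟩ := hgz
    have hwN : (n : ℤ) ^ 2 + 1 = p * w.norm := by
      have := congrArg Zsqrtd.norm hw
      rwa [hzn, Zsqrtd.norm_mul, hgN, pow_one] at this
    have hw0 : 0 ≤ w.norm := GaussianInt.norm_nonneg w
    have hw1 : w.norm ≠ 1 := by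
      intro h1
      rw [h1, mul_one] at hwN
      have hnp' : n ^ 2 + 1 = p := by
        exact_mod_cast (show ((n ^ 2 + 1 : ℕ) : ℤ) = p by push_cast; exact hwN)
      exact hnp (by rw [hnp']; exact hp)
    have hw0' : w.norm ≠ 0 := by
      intro h0
      rw [h0, mul_zero] at hwN
      nlinarith [sq_nonneg (n : ℤ)]
    refine ⟨g.re, g.im, w.re, w.im, ?_, ?_, ?_, ?_⟩
    · have := congrArg Zsqrtd.im hw
      rw [Zsqrtd.im_mul, hz] at this
      simpa using this.symm
    · have := congrArg Zsqrtd.re hw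
      rw [Zsqrtd.re_mul, hz] at this
      simp at this
      linarith
    · have e : g.re ^ 2 + g.im ^ 2 = g.norm := by rw [Zsqrtd.norm_def]; ring
      rw [e, hgN, pow_one]; exact_mod_cast hp.one_lt
    · have e : w.re ^ 2 + w.im ^ 2 = w.norm := by rw [Zsqrtd.norm_def]; ring
      rw [e]; omega
  · -- `N(g) = p²`: then `t` is a unit and `p ∣ g ∣ z`.
    have htN : t.norm = 1 := by
      have hp0 : (p : ℤ) ^ 2 ≠ 0 := pow_ne_zero 2 (by exact_mod_cast hp.ne_zero)
      rw [hgN] at hnorm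
      exact mul_left_cancel₀ hp0 (by rw [mul_one, ← hnorm, sq])
    have htu : IsUnit t := (Zsqrtd.norm_eq_one_iff' (by norm_num) t).mp htN
    exact (hpz (ht ▸ htu.mul_right_dvd.mpr (hg ▸ EuclideanDomain.gcd_dvd_left _ _))).elim

/-- **Dictionary.**  For `n ≥ 1`: `n² + 1` is prime iff every unimodular factorisation of `n`
(`ad + bc = 1`, `ac − bd = n`) is trivial. [folklore] -/
theorem sq_add_one_prime_iff_unimodular {n : ℕ} (hn : 1 ≤ n) :
    (n ^ 2 + 1).Prime ↔
      ∀ a b c d : ℤ, a * d + b * c = 1 → a * c - b * d = n → a ^ 2 + b ^ 2 = 1 ∨ c ^ 2 + d ^ 2 = 1 := by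
  refine ⟨fun hp a b c d h1 h2 ↦ unimodular_trivial_of_prime hp h1 h2, fun h ↦ ?_⟩
  by_contra hnp
  obtain ⟨a, b, c, d, h1, h2, ha, hc⟩ := exists_unimodular_of_not_prime hn hnp
  rcases h a b c d h1 h2 with h | h <;> omega

end Summit.Parity.BatemanHorn.Theorems
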